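import Summits.Ventures.PercRepro.RankLevelSetUpTo2
import Summits.Ventures.PercRepro.SevenThreeQThree

/-!
# PercRepro — C-025 for `q ≤ 3` as ONE statement: `C025UpTo 3` (p3, gen 19; sub-claim S0)

The rows `q = 0, 1, 2, 3` of `C025` on every finite matroid, every `p ≥ q + 2`, as one kernel Prop — the tree form
of sub-claim S0 (RULING (ug)): typer-2's `C025UpTo_two` (Theorem A at `q = 0`: `c025_of_q_zero`; Theorem B at
`q = 1`: `c025_of_q_one`; Theorem N at `q = 2`: `c025_of_q_two`) together with the `q = 3` row
`SevenThree.c025_three_all` (the `(7,3)` cell: `ThmN.RLS M p 3` for every finite matroid and every `p ≥ 5`, the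
`C025` body at `q = 3` token for token).  Axioms: standard.
-/

namespace PercRepro

/-- **C-025 holds for `q ≤ 3`** on every finite matroid and every `p ≥ q + 2`: the rows `q ≤ 2`
(`C025UpTo_two`) and the `q = 3` row (`SevenThree.c025_three_all`; `ThmN.RLS M p 3` is the `C025` body at
`(M, p, 3)` by definition). -/
theorem C025UpTo_three : C025UpTo 3 := by
  intro α M _ p q hq hpq
  rcases Nat.lt_or_ge q 3 with hlt | hge
  · exact C025UpTo_two M p q (Nat.le_of_lt_succ hlt) hpq
  · have hq3 : q = 3 := le_antisymm hq hge
    subst hq3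
    exact SevenThree.c025_three_all M p hpq

end PercRepro
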